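import Literature.Probability.RandomPlanarGeometry.AngleTiltFunction
import HarnessLib

/-!
# The invariant density of the SLE_κ(ρ) angle diffusion

Topic `Probability/RandomPlanarGeometry`; one definition with body (`angleDensity`) and proved
theorems (no named fact). The generator `L = (κ/2) d²/dx² + ((ρ+2)/2) cot(x/2) d/dx` of the
SLE_κ(ρ) angle diffusion `dX = ((ρ+2)/2) cot(X/2) dt + √κ dB` on `(0, 2π)` (`angleGenerator`,
Miller–Sheffield (2013), §2.1.2) is in divergence form with respect to the density
`p(x) = sin(x/2)^{2(ρ+2)/κ}`: `(L f) p = (κ/2) (p f')'`. Consequently `∫₀^{2π} (L f) p dx = 0` for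
every `C²` test function compactly supported in `(0, 2π)` — `p` is an (infinitesimally)
**invariant density**, the density of the stationary angle law of Miller–Sheffield (2013),
Prop. 2.1 in the non-hitting regime (Lawler's radial Bessel process: invariant density
`sin^{4a}`… in the `SLE` normalisation `sin(x/2)^{8/κ}` for `ρ = 2`, cf. Zhan (2021), §3). This is
the first step of the construction of the stationary angle law (`IsStationaryAngleLaw`).

* `angleDensity κ ρ x = sin(x/2)^{2(ρ+2)/κ}`;
* `hasDerivAt_angleDensity_mul_deriv` — `((κ/2) p f')' = (L f) p` (everywhere, for `f ∈ C²` with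
  `tsupport f ⊆ (0, 2π)`);
* `integral_angleGenerator_mul_angleDensity` — `∫₀^{2π} (L f)(x) p(x) dx = 0`.

## References

* J. Miller, S. Sheffield, *Imaginary geometry IV*, PTRF 169 (2017), §2.1.2, Prop. 2.1.
  [MillerSheffield2013]
* D. Zhan, *SLE loop measures*, PTRF 179 (2021), §3. [Zhan2021SLELoopMeasures]
-/

noncomputable section

open Set Filter Topology MeasureTheory
open scoped NNReal Real

namespace Literature.Probability.RandomPlanarGeometry

variable {κ : ℝ≥0} {ρ : ℝ} {f : ℝ → ℝ}

/-- The **invariant density** `p(x) = sin(x/2)^{2(ρ+2)/κ}` of the SLE_κ(ρ) angle diffusion on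
`(0, 2π)` (unnormalised). [cite: MillerSheffield2013, Prop. 2.1] -/
def angleDensity (κ : ℝ≥0) (ρ : ℝ) (x : ℝ) : ℝ := Real.sin (x / 2) ^ (2 * (ρ + 2) / (κ : ℝ))

/-- Unfolding of `angleDensity`. [folklore] -/
theorem angleDensity_apply (κ : ℝ≥0) (ρ x : ℝ) :
    angleDensity κ ρ x = Real.sin (x / 2) ^ (2 * (ρ + 2) / (κ : ℝ)) := rfl

/-- `p > 0` on `(0, 2π)`. [folklore] -/
theorem angleDensity_pos {x : ℝ} (hx : x ∈ Ioo 0 (2 * π)) : 0 < angleDensity κ ρ x :=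
  sin_half_rpow_pos hx

/-- `p' = ((ρ+2)/κ) cot(x/2) p` on `(0, 2π)`. [folklore] -/
theorem hasDerivAt_angleDensity {x : ℝ} (hx : x ∈ Ioo 0 (2 * π)) :
    HasDerivAt (angleDensity κ ρ) ((ρ + 2) / (κ : ℝ) * Real.cot (x / 2) * angleDensity κ ρ x) x := by
  have h := hasDerivAt_sin_half_rpow (p := 2 * (ρ + 2) / (κ : ℝ)) hx
  refine (h.congr_of_eventuallyEq (Eventually.of_forall fun y ↦ rfl)).congr_deriv ?_
  rw [angleDensity_apply]; ring

/-- **Divergence form of the generator**: `((κ/2) p f')' = (L f) p` at every point, for `f ∈ C²`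
with `tsupport f ⊆ (0, 2π)` and `κ ≠ 0`. [cite: MillerSheffield2013, §2.1.2] -/
theorem hasDerivAt_angleDensity_mul_deriv (hκ : κ ≠ 0) (hf : ContDiff ℝ 2 f)
    (hsupp : tsupport f ⊆ Ioo 0 (2 * π)) (x : ℝ) :
    HasDerivAt (fun y ↦ (κ : ℝ) / 2 * (angleDensity κ ρ y * deriv f y))
      (angleGenerator κ ρ f x * angleDensity κ ρ x) x := by
  have hκ' : (κ : ℝ) ≠ 0 := by exact_mod_cast hκ
  have hdf : Differentiable ℝ (deriv f) :=
    ((contDiff_succ_iff_deriv.1 (show ContDiff ℝ (1 + 1) f from hf)).2.2).differentiable one_ne_zero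
  by_cases hx : x ∈ tsupport f
  · have hxI := hsupp hx
    have h1 := hasDerivAt_angleDensity (κ := κ) (ρ := ρ) hxI
    have h2 : HasDerivAt (deriv f) (iteratedDeriv 2 f x) x := by
      rw [iteratedDeriv_succ, iteratedDeriv_one]; exact (hdf x).hasDerivAt
    have h3 := (h1.mul h2).const_mul ((κ : ℝ) / 2)
    refine h3.congr_deriv ?_
    rw [angleGenerator]
    field_simp
    ring
  · -- off the support everything vanishes near `x`
    have hev : deriv f =ᶠ[𝓝 x] fun _ ↦ 0 := deriv_eventuallyEq_zero_of_notMem_tsupport hx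
    have hF : (fun y ↦ (κ : ℝ) / 2 * (angleDensity κ ρ y * deriv f y)) =ᶠ[𝓝 x] fun _ ↦ 0 := by
      filter_upwards [hev] with y hy
      simp [hy]
    rw [angleGenerator_eq_zero_of_notMem_tsupport hx, zero_mul]
    exact (hasDerivAt_const x (0 : ℝ)).congr_of_eventuallyEq hF

/-- `(L f) p` is continuous (`f ∈ C²`, `tsupport f ⊆ (0, 2π)`). [folklore] -/
theorem continuous_angleGenerator_mul_angleDensity (hf : ContDiff ℝ 2 f) (hsupp : tsupport f ⊆ Ioo 0 (2 * π)) :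
    Continuous fun x ↦ angleGenerator κ ρ f x * angleDensity κ ρ x := by
  refine continuous_iff_continuousAt.2 fun x ↦ ?_
  by_cases hx : x ∈ tsupport f
  · exact ((continuous_angleGenerator hf hsupp).continuousAt).mul
      (contDiffAt_sin_half_rpow (n := 0) (hsupp hx)).continuousAt
  · have hev : (fun y ↦ angleGenerator κ ρ f y * angleDensity κ ρ y) =ᶠ[𝓝 x] fun _ ↦ 0 := by
      have h0 : ∀ᶠ y in 𝓝 x, y ∉ tsupport f := (isClosed_tsupport f).isOpen_compl.mem_nhds hx
      filter_upwards [h0] with y hy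
      rw [angleGenerator_eq_zero_of_notMem_tsupport hy, zero_mul]
    exact (continuousAt_const.congr_of_eventuallyEq hev :)

/-- **`p` is an invariant density**: `∫₀^{2π} (L f)(x) p(x) dx = 0` for every `C²` test function
compactly supported in `(0, 2π)` (`κ ≠ 0`). [cite: MillerSheffield2013, Prop. 2.1] -/
theorem integral_angleGenerator_mul_angleDensity (hκ : κ ≠ 0) (hf : ContDiff ℝ 2 f)
    (hsupp : tsupport f ⊆ Ioo 0 (2 * π)) :
    ∫ x in (0 : ℝ)..(2 * π), angleGenerator κ ρ f x * angleDensity κ ρ x = 0 := by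
  have hderiv := hasDerivAt_angleDensity_mul_deriv (ρ := ρ) hκ hf hsupp
  rw [intervalIntegral.integral_eq_sub_of_hasDerivAt (fun x _ ↦ hderiv x)
    ((continuous_angleGenerator_mul_angleDensity hf hsupp).intervalIntegrable _ _)]
  have h0 : (0 : ℝ) ∉ tsupport f := fun h ↦ (lt_irrefl (0 : ℝ)) (hsupp h).1
  have h2π : (2 * π : ℝ) ∉ tsupport f := fun h ↦ (lt_irrefl (2 * π : ℝ)) (hsupp h).2
  rw [(deriv_eventuallyEq_zero_of_notMem_tsupport h0).eq_of_nhds,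
    (deriv_eventuallyEq_zero_of_notMem_tsupport h2π).eq_of_nhds]
  simp

end Literature.Probability.RandomPlanarGeometry
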